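import Summits.HodgeConjecture.HodgeConjecture.Theorems.CYFormCasimirCYFormCarrierEightBetaDiagonal
import HarnessLib

/-!
# Crux X1 `CYFormCarrierEight` (route `CYFormCasimir`, stmt-HodgeConjecture-23493), helper file 11:
# the pairing `ρ_v(z, x) = tr((z ∪ x) ∪ v)` of `⋀⁴W` with itself against a generator `v` of `⋀⁸W^*` — anti-diagonal and non-degenerate

research route conditional on HC_CM; not a corollary. Nothing here proves HC, HC_CM, the rung H2, X1 or `stub_cyform_exists`;
last input of step S1 / first input of S2 of `Cruxes/CYFormCarrierEight/STUB-PLAN-stub_cyform_exists.md`: the Hodge star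
`s₊ : ⋀⁴W → ⋀⁴W^*` is to be defined by `β(z, s₊ x) = ρ(z, x)` (`β` perfect and diagonal: helper files 8, 10); this file shows that
`ρ` is ANTI-DIAGONAL and non-degenerate in the Weil frame.

For the Weil frame `bW = (w, w^*)` of a Weil eightfold and `4`-subsets `I, K` of the `w`-indices:
* `cup_monB_castAdd_castAdd_eq_zero_of_ne_compl` — `w_K ∪ w_I = 0` unless `K = Iᶜ` (two `4`-subsets of an `8`-set that are
  not complementary share an index);
* `tr_cup_monB_castAdd_compl_ne_zero` — `tr((w_{Iᶜ} ∪ w_I) ∪ v) ≠ 0` for every non-zero `v ∈ ⋀⁸W^* = weilClassesMinus A φ 4 d`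
  (`w_{Iᶜ} ∪ w_I = ± w_[8]`, `v = c · w^*_[8]` on the line `⋀⁸W^*`, and `w_[8] ∪ w^*_[8] = ± b_top ≠ 0`).

References: vanGeemen1994HodgeAV (proof of Thm. 6.12), FriedmanLaza2013 (§3.5 Lemma 36), LangeBirkenhake1992 (Lemma 1.1.17).
-/

-- `Summit.HodgeConjecture.HodgeConjecture.…` is the tree's mandated summit/problem namespace (single-problem summit).
set_option linter.dupNamespace false
noncomputable section

open CategoryTheory
open Literature.AlgebraicTopology.SingularHomology
open Literature.AlgebraicGeometry.Motives
open Literature.AlgebraicGeometry.HodgeTheory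
open Literature.AlgebraicGeometry.VanGeemen1994

namespace Summit.HodgeConjecture.HodgeConjecture.Theorems.CYFormCarrier

section Rho

variable {A : AbelianVariety ℂ} {d : ℕ} {φ : A ⟶ A}
variable (hn : 2 ≤ 4) (hd : 0 < d) (hA : A.dim = 2 * 4) (hφ : φ ≫ φ = -(d • 𝟙 A))
  (e : ProjectiveEmbedding A.X) {a : complexBetti (projectiveSpace e.n ℂ) 2} (ha : IsRationalClass a)
  (ha0 : a ≠ 0)

/-- Two `q`-subsets of a `2q`-set that are not complementary share an element. [folklore] -/
theorem exists_mem_mem_of_ne_compl {k q : ℕ} (hqk : q + q = Fintype.card (Fin k)) (I K : Set.powersetCard (Fin k) q)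
    (h : K ≠ Set.powersetCard.compl hqk I) : ∃ j, j ∈ K.val ∧ j ∈ I.val := by
  classical
  by_contra hno
  push Not at hno
  apply h
  apply Subtype.ext
  refine Finset.eq_of_subset_of_card_le (fun j hj ↦ ?_) ?_
  · rw [Set.powersetCard.coe_compl, Finset.mem_compl]
    exact hno j hj
  · rw [Set.powersetCard.card_eq, Set.powersetCard.card_eq]

/-- **`w_K ∪ w_I = 0` unless `K = Iᶜ`** (a shared `w`-factor squares to zero). [cite: LangeBirkenhake1992, Lemma 1.1.17] -/
theorem cup_monB_castAdd_castAdd_eq_zero_of_ne_compl (hqk : 2 * 2 + 2 * 2 = Fintype.card (Fin (2 * 4)))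
    (I K : Set.powersetCard (Fin (2 * 4)) (2 * 2)) (h : K ≠ Set.powersetCard.compl hqk I) :
    cupProduct (show 2 * 2 + 2 * 2 = 2 * 4 from rfl)
        (monB (bW hn hd hA hφ e ha ha0) (2 * 2) (Set.powersetCard.map (2 * 2) (Fin.castAddEmb (2 * 4)) K))
        (monB (bW hn hd hA hφ e ha ha0) (2 * 2) (Set.powersetCard.map (2 * 2) (Fin.castAddEmb (2 * 4)) I)) = 0 := by
  obtain ⟨j, hjK, hjI⟩ := exists_mem_mem_of_ne_compl hqk I K h
  refine CYFormSquare.cupProduct_monB_monB_eq_zero_of_mem _ _ _ _ (j := Fin.castAdd (2 * 4) j) ?_ ?_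
  · rw [Set.powersetCard.val_map]; exact Finset.mem_map_of_mem _ hjK
  · rw [Set.powersetCard.val_map]; exact Finset.mem_map_of_mem _ hjI

include hn hd hA hφ e ha ha0 in
/-- **`tr((w_{Iᶜ} ∪ w_I) ∪ v) ≠ 0`** for every non-zero `v` on the line `⋀⁸W^* = weilClassesMinus A φ 4 d`.
[cite: vanGeemen1994HodgeAV, proof of Thm. 6.12] [cite: LangeBirkenhake1992, Lemma 1.1.17 and Exercise 1.1.6 (8)] -/
theorem tr_cup_monB_castAdd_compl_ne_zero (hqk : 2 * 2 + 2 * 2 = Fintype.card (Fin (2 * 4)))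
    (I : Set.powersetCard (Fin (2 * 4)) (2 * 2)) {v : complexBetti A.X (2 * 4)}
    (hv : v ∈ weilClassesMinus A φ 4 d) (hv0 : v ≠ 0) :
    topCoord (dim_eq_seven_add_one hA)
        (cupProduct (show 2 * 4 + 2 * 4 = 2 + 2 * 7 from rfl)
          (cupProduct (show 2 * 2 + 2 * 2 = 2 * 4 from rfl)
            (monB (bW hn hd hA hφ e ha ha0) (2 * 2)
              (Set.powersetCard.map (2 * 2) (Fin.castAddEmb (2 * 4)) (Set.powersetCard.compl hqk I)))
            (monB (bW hn hd hA hφ e ha ha0) (2 * 2) (Set.powersetCard.map (2 * 2) (Fin.castAddEmb (2 * 4)) I)))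
          v) ≠ 0 := by
  classical
  set b := bW hn hd hA hφ e ha ha0 with hb
  -- `w_{Iᶜ} ∪ w_I = ε₁ T₊`
  have hdisj : Disjoint (Set.powersetCard.map (2 * 2) (Fin.castAddEmb (2 * 4)) (Set.powersetCard.compl hqk I)).val
      (Set.powersetCard.map (2 * 2) (Fin.castAddEmb (2 * 4)) I).val := by
    rw [Set.powersetCard.val_map, Set.powersetCard.val_map, Finset.disjoint_left]
    rintro p hp hp'
    obtain ⟨i, hi, rfl⟩ := Finset.mem_map.1 hp
    obtain ⟨i', hi', hii'⟩ := Finset.mem_map.1 hp'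
    rw [(Fin.castAddEmb (2 * 4)).injective hii'] at hi'
    rw [Set.powersetCard.coe_compl, Finset.mem_compl] at hi
    exact hi hi'
  have hunion : (topPlusIdx (2 * 4)).val =
      (Set.powersetCard.map (2 * 2) (Fin.castAddEmb (2 * 4)) (Set.powersetCard.compl hqk I)).val ∪
        (Set.powersetCard.map (2 * 2) (Fin.castAddEmb (2 * 4)) I).val := by
    rw [Set.powersetCard.val_map, Set.powersetCard.val_map, Set.powersetCard.coe_compl, ← Finset.map_union]
    change (Finset.univ : Finset (Fin (2 * 4))).map (Fin.castAddEmb (2 * 4)) = _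
    congr 1
    rw [Finset.union_comm, Finset.union_compl]
  obtain ⟨ε₁, hε₁, h₁⟩ := cupProduct_monB_monB_of_disjoint b (show 2 * 2 + 2 * 2 = 2 * 4 from rfl) _ _
    (topPlusIdx (2 * 4)) hdisj hunion
  -- `v = c • T₋`
  have hΛ := hasExteriorCohomologyH1 A
  have hb₁ : Module.finrank ℂ (complexBetti A.X 1) = 2 * (2 * 4) := by
    rw [abelianVarietyCohomologyExteriorH1_holds.finrank_one A, hA]
  have hTM := TM_mem_weilClassesMinus hn hd hA hφ e ha ha0
  have hTM0 : TM hn hd hA hφ e ha ha0 ≠ 0 := Module.Basis.ne_zero _ _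
  obtain ⟨c, hc⟩ := Submodule.mem_span_singleton.1 (weilClassesMinus_le_span_singleton hΛ hb₁ hd hφ hTM hTM0 hv)
  have hc0 : c ≠ 0 := by rintro rfl; exact hv0 (by rw [← hc, zero_smul])
  -- `T₊ ∪ T₋ = ε₂ b_top`
  have hdisj2 : Disjoint (topPlusIdx (2 * 4)).val (topMinusIdx (2 * 4)).val :=
    disjoint_map_castAddEmb_map_natAddEmb (k := 2 * 4) (q := 2 * 4)
      (Set.powersetCard.ofCard (s := Finset.univ) (by rw [Finset.card_univ, Fintype.card_fin]))
      (Set.powersetCard.ofCard (s := Finset.univ) (by rw [Finset.card_univ, Fintype.card_fin]))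
  have hcardT : ((topPlusIdx (2 * 4)).val ∪ (topMinusIdx (2 * 4)).val).card = 2 + 2 * 7 := by
    rw [Finset.card_union_of_disjoint hdisj2, Set.powersetCard.card_eq, Set.powersetCard.card_eq]
  set T : Set.powersetCard (Fin (2 * 4 + 2 * 4)) (2 + 2 * 7) := Set.powersetCard.ofCard hcardT with hT
  obtain ⟨ε₂, hε₂, h₂⟩ := cupProduct_monB_monB_of_disjoint b (show 2 * 4 + 2 * 4 = 2 + 2 * 7 from rfl)
    (topPlusIdx (2 * 4)) (topMinusIdx (2 * 4)) T hdisj2 rfl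
  -- assemble
  rw [h₁, ← hc, LinearMap.map_smul₂, map_smul, map_smul, map_smul]
  change ε₁ • c • topCoord (dim_eq_seven_add_one hA)
    (cupProduct (show 2 * 4 + 2 * 4 = 2 + 2 * 7 from rfl) (TP hn hd hA hφ e ha ha0) (TM hn hd hA hφ e ha ha0)) ≠ 0
  rw [show TP hn hd hA hφ e ha ha0 = monB b (2 * 4) (topPlusIdx (2 * 4)) from rfl,
    show TM hn hd hA hφ e ha ha0 = monB b (2 * 4) (topMinusIdx (2 * 4)) from rfl, h₂, map_smul, smul_eq_mul,
    smul_eq_mul, smul_eq_mul]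
  have hT0 : topCoord (dim_eq_seven_add_one hA) (monB b (2 + 2 * 7) T) ≠ 0 := by
    intro h0
    have h := topCoord_smul_topGen (dim_eq_seven_add_one hA) (monB b (2 + 2 * 7) T)
    rw [h0, zero_smul] at h
    exact (Module.Basis.ne_zero (monB b (2 + 2 * 7)) T) h.symm
  have hε₁0 : ε₁ ≠ 0 := fun h ↦ by rw [h, mul_zero] at hε₁; exact zero_ne_one hε₁
  have hε₂0 : ε₂ ≠ 0 := fun h ↦ by rw [h, mul_zero] at hε₂; exact zero_ne_one hε₂
  exact mul_ne_zero hε₁0 (mul_ne_zero hc0 (mul_ne_zero hε₂0 hT0))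

end Rho

end Summit.HodgeConjecture.HodgeConjecture.Theorems.CYFormCarrier

end
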